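import Literature.Probability.LatticeModels.TorusMomentaInRotatedBox
import Mathlib.Analysis.SpecificLimits.Basic
import Mathlib.Data.Nat.Log
import HarnessLib

/-!
# Anisotropic lattice sums: `Σ_{z ∈ ℤ²} (1 + s₁|⟨z,n⟩| + s₂|⟨z,τ⟩|)^{-m} ≤ C/(s₁s₂)`

Topic `Literature/Probability/LatticeModels`; the position-space counterpart of `TorusMomentaInRotatedBox.lean`.  The
`L¹` norm of a single-scale anisotropic sector propagator (Benfatto–Giuliani–Mastropietro 2006, (2.81):
`∫ dx |g^{(h)}_ω(x)| ≤ C γ^{-h}`) is its sup `γ^{3h/2}` times the "volume" `γ^{-h} · γ^{-h} · γ^{-h/2}` of the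
anisotropic region where it lives, `{|x₀| ≲ γ^{-h}, |x'₁| ≲ γ^{-h}, |x'₂| ≲ γ^{-h/2}}`; on the lattice this volume is a
lattice-point SUM of the decay factor, estimated here by dyadic shells and the rotated-box count:

* **`sum_inv_pow_le_of_card_le`** — the dyadic-shell estimate: if `f ≥ 1` on a finite index set and
  `#{f ≤ R} ≤ A R²` for all `R ≥ 1`, then `Σ f^{-m} ≤ 8A` for every `m ≥ 3`;
* `card_filter_frame_le_of_int` — integer points of the plane in a rotated rectangle: for an orthonormal frame
  `(n, τ)` and any finite `P ⊆ ℤ²`, `#{z ∈ P : |⟨z,n⟩| ≤ R₁, |⟨z,τ⟩| ≤ R₂} ≤ (2√2 R₁ + 2)(2√2 R₂ + 2)`;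
* **`sum_inv_pow_frame_le`** — for `s₁, s₂ > 0`, `m ≥ 3` and any finite `P ⊆ ℤ²`:
  `Σ_{z ∈ P} (1 + s₁|⟨z,n⟩| + s₂|⟨z,τ⟩|)^{-m} ≤ 8 (2√2/s₁ + 2)(2√2/s₂ + 2)`, uniformly in `P`.

Everything is proved; no definitions, no named facts. [folklore]

## Sources

G. Benfatto, A. Giuliani, V. Mastropietro, Ann. Henri Poincaré 7 (2006) 809–898, §2.6 (2.81) and Lemma 2.2
(`BenfattoGiulianiMastropietro2006`).  Routine ("folklore").
-/

noncomputable section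

open Finset
open scoped Real

namespace Literature.Probability.LatticeModels

/-! ### The dyadic-shell estimate -/

/-- **Dyadic shells**: on a finite index set let `f ≥ 1` with the quadratic counting bound `#{f ≤ R} ≤ A R²` for all
`R ≥ 1`; then `Σ_z (f z)^{-m} ≤ 8A` for every `m ≥ 3`. [folklore] -/
theorem sum_inv_pow_le_of_card_le {α : Type*} [Fintype α] (f : α → ℝ) (hf : ∀ z, 1 ≤ f z) {A : ℝ} (hA : 0 ≤ A)
    (hcount : ∀ R : ℝ, 1 ≤ R → (((univ.filter fun z => f z ≤ R).card : ℕ) : ℝ) ≤ A * R ^ 2) {m : ℕ} (hm : 3 ≤ m) :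
    ∑ z, (f z)⁻¹ ^ m ≤ 8 * A := by
  classical
  -- the dyadic scale of each point
  set j : α → ℕ := fun z => Nat.log 2 ⌊f z⌋₊ with hj
  have hfloor : ∀ z, 1 ≤ ⌊f z⌋₊ := fun z => Nat.le_floor (by exact_mod_cast hf z)
  have hlow : ∀ z, (2 : ℝ) ^ (j z) ≤ f z := fun z => by
    have h := Nat.pow_log_le_self 2 (Nat.one_le_iff_ne_zero.1 (hfloor z))
    calc (2 : ℝ) ^ (j z) = ((2 ^ Nat.log 2 ⌊f z⌋₊ : ℕ) : ℝ) := by push_cast; rfl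
      _ ≤ (⌊f z⌋₊ : ℝ) := by exact_mod_cast h
      _ ≤ f z := Nat.floor_le (zero_le_one.trans (hf z))
  have hup : ∀ z, f z ≤ (2 : ℝ) ^ (j z + 1) := fun z => by
    have h := Nat.lt_pow_succ_log_self (b := 2) one_lt_two ⌊f z⌋₊
    have h' : (⌊f z⌋₊ : ℝ) + 1 ≤ ((2 ^ (Nat.log 2 ⌊f z⌋₊ + 1) : ℕ) : ℝ) := by exact_mod_cast h
    calc f z ≤ (⌊f z⌋₊ : ℝ) + 1 := (Nat.lt_floor_add_one (f z)).le
      _ ≤ ((2 ^ (Nat.log 2 ⌊f z⌋₊ + 1) : ℕ) : ℝ) := h'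
      _ = (2 : ℝ) ^ (j z + 1) := by push_cast; rfl
  -- termwise: `f^{-m} ≤ (2^{-j})^m ≤ 2^{-j} · 4^{-j}`
  have hterm : ∀ z, (f z)⁻¹ ^ m ≤ ((2 : ℝ) ^ (j z))⁻¹ ^ m := fun z =>
    pow_le_pow_left₀ (inv_nonneg.2 (zero_le_one.trans (hf z))) (inv_anti₀ (by positivity) (hlow z)) m
  have hgeo : ∀ k : ℕ, ((2 : ℝ) ^ k)⁻¹ ^ m ≤ ((1 / 2 : ℝ)) ^ k * ((4 : ℝ) ^ k)⁻¹ := fun k => by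
    have hle1 : ((2 : ℝ) ^ k)⁻¹ ≤ 1 := inv_le_one_of_one_le₀ (one_le_pow₀ (by norm_num))
    calc ((2 : ℝ) ^ k)⁻¹ ^ m ≤ ((2 : ℝ) ^ k)⁻¹ ^ 3 := pow_le_pow_of_le_one (by positivity) hle1 hm
      _ = ((1 / 2 : ℝ)) ^ k * ((4 : ℝ) ^ k)⁻¹ := by
          rw [show (4 : ℝ) = 2 * 2 by norm_num, mul_pow, mul_inv, one_div, ← inv_pow]; ring
  -- group by the dyadic scale
  have hfib : ∑ z, ((2 : ℝ) ^ (j z))⁻¹ ^ m = ∑ k ∈ univ.image j, ((univ.filter fun z => j z = k).card : ℝ) * ((2 : ℝ) ^ k)⁻¹ ^ m := by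
    rw [Finset.sum_comp (fun k : ℕ => ((2 : ℝ) ^ k)⁻¹ ^ m) j]
    simp only [nsmul_eq_mul]
  have hcardk : ∀ k : ℕ, (((univ.filter fun z => j z = k).card : ℕ) : ℝ) ≤ A * 4 * (4 : ℝ) ^ k := by
    intro k
    have hsub : (univ.filter fun z => j z = k) ⊆ univ.filter fun z => f z ≤ (2 : ℝ) ^ (k + 1) := by
      intro z hz
      simp only [mem_filter, mem_univ, true_and] at hz ⊢
      calc f z ≤ (2 : ℝ) ^ (j z + 1) := hup z
        _ = (2 : ℝ) ^ (k + 1) := by rw [hz]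
    have h1 : (((univ.filter fun z => j z = k).card : ℕ) : ℝ) ≤ (((univ.filter fun z => f z ≤ (2 : ℝ) ^ (k + 1)).card : ℕ) : ℝ) := by
      exact_mod_cast card_le_card hsub
    have h2 := hcount ((2 : ℝ) ^ (k + 1)) (one_le_pow₀ (by norm_num))
    have h3 : A * ((2 : ℝ) ^ (k + 1)) ^ 2 = A * 4 * (4 : ℝ) ^ k := by
      rw [← pow_mul, show (k + 1) * 2 = 2 * k + 2 by ring, pow_add, pow_mul]; norm_num; ring
    linarith
  -- the geometric sum
  have hgeosum : ∑ k ∈ univ.image j, ((1 / 2 : ℝ)) ^ k ≤ 2 := by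
    calc ∑ k ∈ univ.image j, ((1 / 2 : ℝ)) ^ k ≤ ∑' k : ℕ, ((1 / 2 : ℝ)) ^ k :=
          summable_geometric_two.sum_le_tsum _ (fun k _ => by positivity)
      _ = 2 := tsum_geometric_two
  calc ∑ z, (f z)⁻¹ ^ m ≤ ∑ z, ((2 : ℝ) ^ (j z))⁻¹ ^ m := sum_le_sum fun z _ => hterm z
    _ = ∑ k ∈ univ.image j, ((univ.filter fun z => j z = k).card : ℝ) * ((2 : ℝ) ^ k)⁻¹ ^ m := hfib
    _ ≤ ∑ k ∈ univ.image j, (A * 4 * (4 : ℝ) ^ k) * (((1 / 2 : ℝ)) ^ k * ((4 : ℝ) ^ k)⁻¹) :=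
        sum_le_sum fun k _ => mul_le_mul (hcardk k) (hgeo k) (by positivity) (by positivity)
    _ = 4 * A * ∑ k ∈ univ.image j, ((1 / 2 : ℝ)) ^ k := by
        rw [mul_sum]
        refine sum_congr rfl fun k _ => ?_
        have h4 : (4 : ℝ) ^ k ≠ 0 := by positivity
        field_simp
    _ ≤ 4 * A * 2 := mul_le_mul_of_nonneg_left hgeosum (by positivity)
    _ = 8 * A := by ring

/-! ### Integer points in a rotated rectangle -/

/-- **Integer points of the plane in a rotated rectangle**: for an orthonormal frame `(n, τ)` and any finite `P ⊆ ℤ²`,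
`#{z ∈ P : |⟨z,n⟩| ≤ R₁, |⟨z,τ⟩| ≤ R₂} ≤ (2√2 R₁ + 2)(2√2 R₂ + 2)` (frame coordinates closer than `1/√2` force
equality of integer points). [folklore] -/
theorem card_filter_frame_le_of_int (P : Finset (ℤ × ℤ)) {n τ : Fin 2 → ℝ} (hn : n 0 ^ 2 + n 1 ^ 2 = 1)
    (hτ : τ 0 ^ 2 + τ 1 ^ 2 = 1) (hnτ : n 0 * τ 0 + n 1 * τ 1 = 0) {R₁ R₂ : ℝ} (hR₁ : 0 ≤ R₁) (hR₂ : 0 ≤ R₂) :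
    (((univ.filter fun z : P => |((z.1.1 : ℝ)) * n 0 + ((z.1.2 : ℝ)) * n 1| ≤ R₁ ∧
        |((z.1.1 : ℝ)) * τ 0 + ((z.1.2 : ℝ)) * τ 1| ≤ R₂).card : ℕ) : ℝ) ≤
      (2 * Real.sqrt 2 * R₁ + 2) * (2 * Real.sqrt 2 * R₂ + 2) := by
  have hs2 : (0 : ℝ) < Real.sqrt 2 := Real.sqrt_pos.2 two_pos
  have hs2sq : Real.sqrt 2 ^ 2 = 2 := Real.sq_sqrt two_pos.le
  have hδ : (0 : ℝ) < (Real.sqrt 2)⁻¹ := inv_pos.2 hs2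
  have h := card_filter_abs_le_le_of_separated (fun z : P => ((z.1.1 : ℝ)) * n 0 + ((z.1.2 : ℝ)) * n 1)
    (fun z : P => ((z.1.1 : ℝ)) * τ 0 + ((z.1.2 : ℝ)) * τ 1) hδ (fun a b hX hY => ?_) hR₁ hR₂
  · refine h.trans (le_of_eq ?_)
    rw [div_inv_eq_mul, div_inv_eq_mul]
    ring
  -- separation: the difference of two integer points with small frame coordinates is zero
  set u : Fin 2 → ℝ := ![((a.1.1 : ℝ)) - ((b.1.1 : ℝ)), ((a.1.2 : ℝ)) - ((b.1.2 : ℝ))] with hu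
  have hX' : |u 0 * n 0 + u 1 * n 1| < (Real.sqrt 2)⁻¹ := by
    convert hX using 2; simp [hu]; ring
  have hY' : |u 0 * τ 0 + u 1 * τ 1| < (Real.sqrt 2)⁻¹ := by
    convert hY using 2; simp [hu]; ring
  have hA := sq_lt_sq' (abs_lt.1 hX').1 (abs_lt.1 hX').2
  have hB := sq_lt_sq' (abs_lt.1 hY').1 (abs_lt.1 hY').2
  have hsum : u 0 ^ 2 + u 1 ^ 2 < 1 := by
    have h2inv : ((Real.sqrt 2)⁻¹) ^ 2 = 2⁻¹ := by rw [inv_pow, hs2sq]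
    rw [h2inv] at hA hB
    rw [← frame_sq_add_sq_eq hn hτ hnτ u]
    linarith
  have h0 : u 0 ^ 2 < 1 := by nlinarith [sq_nonneg (u 1)]
  have h1 : u 1 ^ 2 < 1 := by nlinarith [sq_nonneg (u 0)]
  have e0 : a.1.1 = b.1.1 := by
    have hlt : |((a.1.1 : ℝ)) - ((b.1.1 : ℝ))| < 1 := by
      have := (sq_lt_one_iff_abs_lt_one (u 0)).1 h0; simpa [hu] using this
    have hint : |a.1.1 - b.1.1| < 1 := by exact_mod_cast hlt
    have := abs_lt.1 hint; omega
  have e1 : a.1.2 = b.1.2 := by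
    have hlt : |((a.1.2 : ℝ)) - ((b.1.2 : ℝ))| < 1 := by
      have := (sq_lt_one_iff_abs_lt_one (u 1)).1 h1; simpa [hu] using this
    have hint : |a.1.2 - b.1.2| < 1 := by exact_mod_cast hlt
    have := abs_lt.1 hint; omega
  exact Subtype.ext (Prod.ext e0 e1)

/-- **The anisotropic lattice sum** (the lattice "volume" of a single-scale sector propagator, Benfatto–Giuliani–
Mastropietro 2006, (2.81)): for an orthonormal frame `(n, τ)`, rates `s₁, s₂ > 0`, `m ≥ 3` and any finite `P ⊆ ℤ²`,
`Σ_{z ∈ P} (1 + s₁|⟨z,n⟩| + s₂|⟨z,τ⟩|)^{-m} ≤ 8 (2√2/s₁ + 2)(2√2/s₂ + 2)`, uniformly in `P`.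
[cite: BenfattoGiulianiMastropietro2006, §2.6 (2.81)] -/
theorem sum_inv_pow_frame_le (P : Finset (ℤ × ℤ)) {n τ : Fin 2 → ℝ} (hn : n 0 ^ 2 + n 1 ^ 2 = 1)
    (hτ : τ 0 ^ 2 + τ 1 ^ 2 = 1) (hnτ : n 0 * τ 0 + n 1 * τ 1 = 0) {s₁ s₂ : ℝ} (hs₁ : 0 < s₁) (hs₂ : 0 < s₂)
    {m : ℕ} (hm : 3 ≤ m) :
    ∑ z ∈ P, (1 + s₁ * |((z.1 : ℝ)) * n 0 + ((z.2 : ℝ)) * n 1| + s₂ * |((z.1 : ℝ)) * τ 0 + ((z.2 : ℝ)) * τ 1|)⁻¹ ^ m ≤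
      8 * ((2 * Real.sqrt 2 / s₁ + 2) * (2 * Real.sqrt 2 / s₂ + 2)) := by
  rw [← Finset.sum_coe_sort]
  set f : P → ℝ := fun z => 1 + s₁ * |((z.1.1 : ℝ)) * n 0 + ((z.1.2 : ℝ)) * n 1| + s₂ * |((z.1.1 : ℝ)) * τ 0 + ((z.1.2 : ℝ)) * τ 1| with hf
  have hf1 : ∀ z, 1 ≤ f z := fun z => by
    simp only [hf]; nlinarith [abs_nonneg (((z.1.1 : ℝ)) * n 0 + ((z.1.2 : ℝ)) * n 1), abs_nonneg (((z.1.1 : ℝ)) * τ 0 + ((z.1.2 : ℝ)) * τ 1)]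
  have hA : 0 ≤ (2 * Real.sqrt 2 / s₁ + 2) * (2 * Real.sqrt 2 / s₂ + 2) := by positivity
  refine sum_inv_pow_le_of_card_le f hf1 hA (fun R hR => ?_) hm
  -- `{f ≤ R} ⊆ {|⟨z,n⟩| ≤ R/s₁, |⟨z,τ⟩| ≤ R/s₂}`
  have hsub : (univ.filter fun z : P => f z ≤ R) ⊆ (univ.filter fun z : P =>
      |((z.1.1 : ℝ)) * n 0 + ((z.1.2 : ℝ)) * n 1| ≤ R / s₁ ∧ |((z.1.1 : ℝ)) * τ 0 + ((z.1.2 : ℝ)) * τ 1| ≤ R / s₂) := by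
    intro z hz
    have h := (mem_filter.1 hz).2
    simp only [hf] at h
    refine mem_filter.2 ⟨mem_univ _, ?_, ?_⟩
    · rw [le_div_iff₀ hs₁]
      nlinarith [abs_nonneg (((z.1.1 : ℝ)) * τ 0 + ((z.1.2 : ℝ)) * τ 1), abs_nonneg (((z.1.1 : ℝ)) * n 0 + ((z.1.2 : ℝ)) * n 1)]
    · rw [le_div_iff₀ hs₂]
      nlinarith [abs_nonneg (((z.1.1 : ℝ)) * τ 0 + ((z.1.2 : ℝ)) * τ 1), abs_nonneg (((z.1.1 : ℝ)) * n 0 + ((z.1.2 : ℝ)) * n 1)]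
  calc (((univ.filter fun z : P => f z ≤ R).card : ℕ) : ℝ)
      ≤ (((univ.filter fun z : P => |((z.1.1 : ℝ)) * n 0 + ((z.1.2 : ℝ)) * n 1| ≤ R / s₁ ∧
          |((z.1.1 : ℝ)) * τ 0 + ((z.1.2 : ℝ)) * τ 1| ≤ R / s₂).card : ℕ) : ℝ) := by exact_mod_cast card_le_card hsub
    _ ≤ (2 * Real.sqrt 2 * (R / s₁) + 2) * (2 * Real.sqrt 2 * (R / s₂) + 2) :=
        card_filter_frame_le_of_int P hn hτ hnτ (by positivity) (by positivity)
    _ ≤ (2 * Real.sqrt 2 / s₁ + 2) * (2 * Real.sqrt 2 / s₂ + 2) * R ^ 2 := by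
        have h2 : (0 : ℝ) ≤ 2 * Real.sqrt 2 := by positivity
        have e : ∀ s : ℝ, 0 < s → 2 * Real.sqrt 2 * (R / s) + 2 ≤ (2 * Real.sqrt 2 / s + 2) * R := by
          intro s hs
          rw [add_mul, show 2 * Real.sqrt 2 / s * R = 2 * Real.sqrt 2 * (R / s) by ring]
          linarith
        calc (2 * Real.sqrt 2 * (R / s₁) + 2) * (2 * Real.sqrt 2 * (R / s₂) + 2)
            ≤ ((2 * Real.sqrt 2 / s₁ + 2) * R) * ((2 * Real.sqrt 2 / s₂ + 2) * R) :=
              mul_le_mul (e s₁ hs₁) (e s₂ hs₂) (by positivity) (by positivity)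
          _ = _ := by ring

end Literature.Probability.LatticeModels
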